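import Mathlib.NumberTheory.NumberField.Discriminant.Different
import Mathlib.RingTheory.Ideal.Norm.RelNorm
import Literature.NumberTheory.Automorphic.ArtinLFunctionsBrauerCompletedProofs
import Literature.NumberTheory.GaloisRepresentations.HasseArfProofs
import Literature.NumberTheory.GaloisRepresentations.ArtinGammaFactorInductionProofs
import HarnessLib

/-!
# Brauer's factorisation of the completed Artin L-function: reduction to Neukirch VII (11.7) (iii)
(companion to `Literature.NumberTheory.Automorphic.ArtinLFunctionsFunctionalEquation`; serves its
named fact `Literature.NumberTheory.Automorphic.brauer_completedArtinLFunction_eq_prod_zpow`,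
Neukirch VII, proof of (12.6), first two displayed equalities)

`ArtinLFunctionsBrauerCompletedProofs` proves the named fact
`brauer_completedArtinLFunction_eq_prod_zpow` granting two inputs: the Hasse–Arf theorem (`hHA`) and
the induction invariance (12.3) (iii) of the completed L-function `Λ = c^{s/2} 𝓛_∞ 𝓛` for
representations induced from characters of degree one (`h3`).  This file discharges everything in
those two inputs that the tree and Mathlib contain, so that **exactly one printed proposition
remains as a hypothesis, Neukirch VII (11.7) (iii)** — the conductor of an induced character,
`𝔣(L|K, χ_*) = 𝔡_{K'|K}^{χ(1)} N_{K'|K}(𝔣(L|K', χ))` — in the precise form in which it is used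
(characters `χ` of degree one; as an identity of ideals of `𝓞 K`, or after absolute norms):

* Hasse–Arf is the theorem `hasseArf_holds` (`HasseArfProofs`), universe polymorphic, so `hHA`
  is discharged outright (`hasseArf_family`);
* (12.3) (iii), "`Λ(L|K, χ_*, s) = Λ(L|K', χ, s)`", is by Definition (12.2) the conjunction of
  (10.4) (iv) for `𝓛` — **proved**, `artinLFunction_eq_of_isInducedFrom_holds`
  (`ArtinFormalismInductionProofs`) —, of (12.1) (iii) for `𝓛_∞` — **proved**,
  `ArtinRep.gammaFactor_eq_of_isInducedFrom` (`ArtinGammaFactorInductionProofs`) —, and of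
  (11.11) (iii) `c(L|K, χ_*) = c(L|K', χ)` for `c(L|K, χ) = |d_K|^{χ(1)} 𝔑(𝔣(L|K, χ))`; and
  (11.11) (iii) is (Neukirch, p. 534: "Applying (11.7) and observing the transitivity of the
  discriminant (chap. III, (2.10))") the conjunction of (11.7) (iii) and of
  `|d_{K'}| = 𝔑(𝔡_{K'|K}) |d_K|^{[K':K]}` — **Mathlib's**
  `NumberField.natAbs_discr_eq_absNorm_differentIdeal_mul_natAbs_discr_pow` (with
  `𝔑(𝔡_{K'|K}) = 𝔑(𝔇_{K'|K})`, the relative different `differentIdeal (𝓞 K) (𝓞 K')`, and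
  `𝔑 ∘ N_{K'|K} = 𝔑`, Mathlib `Ideal.absNorm_relNorm`), while `χ_*(1) = [K':K] χ(1)` is
  `ArtinRep.finrank_eq_of_isInducedFrom`.

Everything here is **proved**; no definitions, no named facts:

* `ArtinRep.artinConductorNorm_eq_of_artinConductorNat_eq` — (11.11) (iii) from (11.7) (iii) in
  norm form `𝔑(𝔣(ρ)) = 𝔑(𝔇_{M/K})^{dim W} 𝔑(𝔣(π))` and the discriminant tower formula;
  `GaloisRep.artinConductorNat_eq_of_artinConductor_eq_relNorm` — the norm form from the ideal
  form `𝔣(ρ) = N_{M|K}(𝔇_{M|K})^{dim W} · N_{M|K}(𝔣(π))`;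
* `completedArtinLFunction_eq_of_isInducedFrom_of_eq`,
  `completedArtinLFunction_eq_of_isInducedFrom_of_artinConductorNat_eq`,
  `completedArtinLFunction_eq_of_isInducedFrom_rankOne_of_artinConductorNat_eq` — (12.3) (iii) from
  (11.7) (iii) (norm form), the other two factors being theorems;
* `brauer_completedArtinLFunction_eq_prod_zpow_of_isInducedFrom` — the named fact from (12.3) (iii)
  for characters of degree one alone (Hasse–Arf discharged);
* `brauer_completedArtinLFunction_eq_prod_zpow_of_artinConductorNat`,
  `brauer_completedArtinLFunction_eq_prod_zpow_of_artinConductor_eq` — **the named fact from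
  (11.7) (iii) alone** (norm form, resp. ideal form as printed), for representations of `Γ_K`
  induced from characters of degree one of finite extensions `M/K`: this is the residual
  obligation; `artin_functional_equation_of_artinConductor_eq_of_rankOne` records what is then
  left of the parent fact `artin_functional_equation` ((11.7) (iii) and
  `artin_functional_equation_rankOne` over all fields);
* `completedArtinLFunction_eq_prod_zpow_of_character_eq_sum_of_monomial`,
  `brauer_completedArtinLFunction_eq_prod_zpow_of_monomial`,
  `brauer_completedArtinLFunction_eq_prod_zpow_of_monomial_artinConductorNat`,
  `brauer_completedArtinLFunction_eq_prod_zpow_of_monomial_artinConductor_eq` — the same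
  reductions phrased for the explicit monomial models `Ind_H^G θ ∘ q` (`ArtinRep.monomial`) and
  the cut-out characters (`IsArtinQuotient.cutCharacter`) only, which is all the core step of
  `ArtinLFunctionsBrauerCompletedProofs` uses: whoever proves (11.7) (iii) may do so either for
  abstract induced representations (`ArtinRep.IsInducedFrom`, as (10.4) (iv) and (12.1) (iii) were
  proved) or for these explicit models.

## Mathlib / tree search

Mathlib: `NumberField.natAbs_discr_eq_absNorm_differentIdeal_mul_natAbs_discr_pow`
(`NumberTheory/NumberField/Discriminant/Different.lean`), `Ideal.relNorm`, `Ideal.absNorm_relNorm`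
(`RingTheory/Ideal/Norm/RelNorm.lean`), `Module.finrank_fin_fun`.  Tree: `hasseArf_holds`;
`artinLFunction_eq_of_isInducedFrom_holds` (`ArtinFormalismInductionProofs`);
`ArtinRep.gammaFactor_eq_of_isInducedFrom`, `ArtinRep.finrank_eq_of_isInducedFrom`
(`ArtinGammaFactorInductionProofs`); `brauer_completedArtinLFunction_eq_prod_zpow_of_isInducedFrom_of_hasseArf`,
`completedArtinLFunction_eq_prod_zpow_of_character_eq_sum`, `HasCompletedArtinRealization.*`,
`completedArtinLFunction_ne_zero` (`ArtinLFunctionsBrauerCompletedProofs`);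
`ArtinRep.isInducedFrom_monomial`, `IsArtinQuotient.cutCharacter_inv`,
`FramedArtinRep.character_dual_eq_conj` (`ArtinLFunctionsBrauerProofs`, `…DualProofs`).
`lean search 'artinConductor.*[Ii]nduc|discr.*artinConductor|relNorm.*artinConductor'`: nothing —
(11.7) (iii) has no statement in the tree; it is kept here as an inline hypothesis (no named
fact, D-0026).  Nothing here duplicates an existing declaration.

## References

* J. Neukirch, *Algebraic Number Theory*, Grundlehren 322 (1999), VII (10.4) (iv), (11.7) (iii),
  (11.11) (iii), (12.1) (iii), (12.2), (12.3) (iii) and the proof of (12.6), pp. 527–541; III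
  (2.9)–(2.10) (`NeukirchANT1999`).
* R. Brauer, *On Artin's L-series with general group characters*, Ann. of Math. (2) 48 (1947),
  502–514, Thm. 1 (`Brauer1947`).
* J.-P. Serre, *Local Fields* (1979), Ch. IV §3 (Hasse–Arf), Ch. VI §§2–3
  (`SerreLocalFields1979`).
-/

noncomputable section

open scoped NumberField ComplexConjugate
open Field Module Literature.RepresentationTheory.FiniteGroups

/-! ### Galois-representation side: degrees, (11.11) (iii), (12.3) (iii) -/

namespace Literature.NumberTheory.GaloisRepresentations

universe u u' w w'

section HasseArf

/-- **The Hasse–Arf theorem in the family form** consumed by the conditional theorems of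
`ArtinFormalismCompletedProdProofs` and `ArtinLFunctionsBrauerCompletedProofs` (all Dedekind
`R' ⊆ K' ⊆ L'` in one universe): an instance of the universe-polymorphic theorem
`hasseArf_holds`. [cite: SerreLocalFields1979, Ch. IV §3, Theorem (Hasse–Arf)] -/
theorem hasseArf_family :
    ∀ (R' K' L' : Type u) [CommRing R'] [Field K'] [Field L'] [Algebra R' K'] [Algebra R' L']
      [Algebra K' L'] [IsScalarTower R' K' L'], hasseArf R' (K := K') (L := L') :=
  fun _ _ _ _ _ _ _ _ _ _ => hasseArf_holds

end HasseArf

section Induced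

variable {K : Type u} [Field K] [NumberField K] {M : Type u'} [Field M] [NumberField M]
  [Algebra K M] {V : Type w} [AddCommGroup V] [Module ℂ V] [TopologicalSpace V]
  [FiniteDimensional ℂ V] {W : Type w'} [AddCommGroup W] [Module ℂ W] [TopologicalSpace W]
  [FiniteDimensional ℂ W]

omit [FiniteDimensional ℂ V] [FiniteDimensional ℂ W] in
/-- **Neukirch VII (11.11) (iii) from (11.7) (iii)** ("Applying (11.7) and observing the
transitivity of the discriminant (chap. III, (2.10))", p. 534).  For Artin representations `ρ` of
`K` on `V` and `π` of the finite extension `M` on `W` with `dim V = [M:K] dim W`, if the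
conductor ideals satisfy (11.7) (iii) in norm form, `𝔑(𝔣(ρ)) = 𝔑(𝔇_{M/K})^{dim W} · 𝔑(𝔣(π))`
(`𝔑(𝔡_{M|K}) = 𝔑(𝔇_{M|K})` for the relative different `differentIdeal (𝓞 K) (𝓞 M)`, and
`𝔑(N_{M|K} 𝔞) = 𝔑(𝔞)`), then `c(ρ) = |d_K|^{dim V} 𝔑(𝔣(ρ)) = |d_M|^{dim W} 𝔑(𝔣(π)) = c(π)`
(`ArtinRep.artinConductorNorm`), by the tower formula
`|d_M| = 𝔑(𝔇_{M/K}) |d_K|^{[M:K]}` (Mathlib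
`NumberField.natAbs_discr_eq_absNorm_differentIdeal_mul_natAbs_discr_pow`).
[cite: NeukirchANT1999, VII (11.11) (iii)] -/
theorem ArtinRep.artinConductorNorm_eq_of_artinConductorNat_eq (ρ : ArtinRep K V)
    (π : ArtinRep M W) (hdim : finrank ℂ V = finrank K M * finrank ℂ W)
    (h𝔣 : GaloisRep.artinConductorNat ρ =
      (differentIdeal (𝓞 K) (𝓞 M)).absNorm ^ finrank ℂ W * GaloisRep.artinConductorNat π) :
    ρ.artinConductorNorm = π.artinConductorNorm := by
  rw [ArtinRep.artinConductorNorm, ArtinRep.artinConductorNorm, h𝔣, hdim,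
    NumberField.natAbs_discr_eq_absNorm_differentIdeal_mul_natAbs_discr_pow K (𝓞 K) M (𝓞 M)]
  ring

omit [FiniteDimensional ℂ V] [FiniteDimensional ℂ W] in
/-- **(11.7) (iii) at the level of ideals implies its norm form**: if
`𝔣(ρ) = 𝔡_{M|K}^{n} · N_{M|K}(𝔣(π))` as ideals of `𝓞 K` — with the relative discriminant
`𝔡_{M|K} = N_{M|K}(𝔇_{M|K})` (Neukirch III (2.9)) and `N_{M|K}` Mathlib's `Ideal.relNorm (𝓞 K)` —
then `𝔑(𝔣(ρ)) = 𝔑(𝔇_{M|K})^{n} · 𝔑(𝔣(π))` (`GaloisRep.artinConductorNat`; Mathlib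
`Ideal.absNorm_relNorm`).  This lets the conductor formula be supplied verbatim as printed.
[cite: NeukirchANT1999, VII (11.7) (iii)] -/
theorem GaloisRep.artinConductorNat_eq_of_artinConductor_eq_relNorm
    (ρ : ArtinRep K V) (π : ArtinRep M W) (n : ℕ)
    (h : GaloisRep.artinConductor ρ =
      Ideal.relNorm (𝓞 K) (differentIdeal (𝓞 K) (𝓞 M)) ^ n *
        Ideal.relNorm (𝓞 K) (GaloisRep.artinConductor π)) :
    GaloisRep.artinConductorNat ρ =
      (differentIdeal (𝓞 K) (𝓞 M)).absNorm ^ n * GaloisRep.artinConductorNat π := by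
  rw [GaloisRep.artinConductorNat, GaloisRep.artinConductorNat, h, map_mul, map_pow,
    Ideal.absNorm_relNorm, Ideal.absNorm_relNorm]

/-- **Neukirch VII (12.3) (iii), `Λ(L|K, χ_*, s) = Λ(L|K', χ, s)`, from its three factors**
(Definition (12.2): `Λ = c^{s/2} 𝓛_∞ 𝓛`, and "the behaviour of the factors `c`, `𝓛_∞`, `𝓛` …
carries over to `Λ`").  For `ρ ≅ Ind_{Γ_M}^{Γ_K} π` (module topologies), granting (11.11) (iii)
`c(ρ) = c(π)` (`hc`) and (12.1) (iii) in product form `γ(ρ, s) = γ(π, s)` (`hγ`), the completed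
L-functions agree on `re s > 1`; the third factor, (10.4) (iv) `𝓛(s, ρ) = 𝓛(s, π)`, is the
theorem `artinLFunction_eq_of_isInducedFrom_holds`.
[cite: NeukirchANT1999, VII (12.3) (iii)] -/
theorem completedArtinLFunction_eq_of_isInducedFrom_of_eq [IsModuleTopology ℂ V]
    [IsModuleTopology ℂ W] (ρ : ArtinRep K V) (π : ArtinRep M W) (h : ρ.IsInducedFrom π)
    (hc : ρ.artinConductorNorm = π.artinConductorNorm)
    (hγ : ∀ s : ℂ, ρ.gammaFactor s = π.gammaFactor s) {s : ℂ} (hs : 1 < s.re) :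
    completedArtinLFunction ρ s = completedArtinLFunction π s := by
  rw [completedArtinLFunction, completedArtinLFunction, hc, hγ s,
    artinLFunction_eq_of_isInducedFrom_holds ρ π h s hs]

/-- **Neukirch VII (12.3) (iii) from (11.7) (iii) in norm form**: for `ρ ≅ Ind_{Γ_M}^{Γ_K} π`
(module topologies) with `𝔑(𝔣(ρ)) = 𝔑(𝔇_{M/K})^{dim W} 𝔑(𝔣(π))`, `Λ(s, ρ) = Λ(s, π)` on
`re s > 1` — (11.11) (iii) by `artinConductorNorm_eq_of_artinConductorNat_eq` with
`dim V = [M:K] dim W` (`ArtinRep.finrank_eq_of_isInducedFrom`), (12.1) (iii) by the theorem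
`ArtinRep.gammaFactor_eq_of_isInducedFrom` (`ArtinGammaFactorInductionProofs`), (10.4) (iv) by
`artinLFunction_eq_of_isInducedFrom_holds`.
[cite: NeukirchANT1999, VII (12.3) (iii), with (11.7) (iii), (11.11) (iii), (12.1) (iii)] -/
theorem completedArtinLFunction_eq_of_isInducedFrom_of_artinConductorNat_eq [IsModuleTopology ℂ V]
    [IsModuleTopology ℂ W] (ρ : ArtinRep K V) (π : ArtinRep M W) (h : ρ.IsInducedFrom π)
    (h𝔣 : GaloisRep.artinConductorNat ρ =
      (differentIdeal (𝓞 K) (𝓞 M)).absNorm ^ finrank ℂ W * GaloisRep.artinConductorNat π)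
    {s : ℂ} (hs : 1 < s.re) : completedArtinLFunction ρ s = completedArtinLFunction π s :=
  completedArtinLFunction_eq_of_isInducedFrom_of_eq ρ π h
    (ArtinRep.artinConductorNorm_eq_of_artinConductorNat_eq ρ π
      (ArtinRep.finrank_eq_of_isInducedFrom ρ π h) h𝔣)
    (ArtinRep.gammaFactor_eq_of_isInducedFrom ρ π h) hs

/-- **(12.3) (iii) for a representation induced from a character of degree one, from
(11.7) (iii) in norm form** — the case through which the proof of (12.6) passes: for
`σ ≅ Ind_{Γ_M}^{Γ_K} π` with `π : Γ_M → GL_1(ℂ)` and `𝔑(𝔣(σ)) = 𝔑(𝔇_{M/K}) 𝔑(𝔣(π))`,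
`Λ(s, σ) = Λ(s, π)` on `re s > 1`.
[cite: NeukirchANT1999, VII (12.3) (iii), with (11.7) (iii), (11.11) (iii), (12.1) (iii)] -/
theorem completedArtinLFunction_eq_of_isInducedFrom_rankOne_of_artinConductorNat_eq
    [IsModuleTopology ℂ V] (σ : ArtinRep K V) (π : FramedArtinRep M 1)
    (h : σ.IsInducedFrom π.toArtinRep)
    (h𝔣 : GaloisRep.artinConductorNat σ =
      (differentIdeal (𝓞 K) (𝓞 M)).absNorm * GaloisRep.artinConductorNat π.toArtinRep)
    {s : ℂ} (hs : 1 < s.re) :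
    completedArtinLFunction σ s = completedArtinLFunction π.toArtinRep s := by
  refine completedArtinLFunction_eq_of_isInducedFrom_of_artinConductorNat_eq σ π.toArtinRep h ?_ hs
  rw [h𝔣, Module.finrank_fin_fun, pow_one]

end Induced

end Literature.NumberTheory.GaloisRepresentations

/-! ### Brauer's factorisation of `Λ`: the residual hypotheses -/

namespace Literature.NumberTheory.Automorphic

universe u

section Lang

variable {K : Type u} [Field K] [NumberField K]

/-- **Brauer's factorisation of the completed Artin L-function from (12.3) (iii) for characters
of degree one** (Neukirch VII, proof of (12.6): "From propositions (12.3) … it follows that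
`Λ(L|K, χ, s) = ∏ᵢ Λ(L|K, χᵢ*, s)^{nᵢ} = ∏ᵢ Λ(L|Kᵢ, χᵢ, s)^{nᵢ}`").  Granting only the induction
invariance (12.3) (iii) of `Λ` for representations of `Γ_K` induced from characters of degree
one of finite extensions (`h3`), the named fact `brauer_completedArtinLFunction_eq_prod_zpow`
holds: `brauer_completedArtinLFunction_eq_prod_zpow_of_isInducedFrom_of_hasseArf` with the
Hasse–Arf theorem supplied by `hasseArf_holds` (`hasseArf_family`).
[cite: NeukirchANT1999, VII (12.6) proof, with (10.3) and (12.3)] [cite: Brauer1947, Thm. 1] -/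
theorem brauer_completedArtinLFunction_eq_prod_zpow_of_isInducedFrom
    (h3 : ∀ (M : Type u) [Field M] [NumberField M] [Algebra K M] (V' : Type) [AddCommGroup V']
      [Module ℂ V'] [TopologicalSpace V'] [FiniteDimensional ℂ V'] [IsModuleTopology ℂ V']
      (σ : GaloisRepresentations.ArtinRep K V') (π : GaloisRepresentations.FramedArtinRep M 1),
      σ.IsInducedFrom π.toArtinRep → ∀ s : ℂ, 1 < s.re →
        GaloisRepresentations.completedArtinLFunction σ s =
          GaloisRepresentations.completedArtinLFunction π.toArtinRep s) :
    brauer_completedArtinLFunction_eq_prod_zpow (K := K) :=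
  brauer_completedArtinLFunction_eq_prod_zpow_of_isInducedFrom_of_hasseArf
    GaloisRepresentations.hasseArf_family h3

/-- **Brauer's factorisation of the completed Artin L-function, reduced to Neukirch VII
(11.7) (iii).**  Granting, for every finite extension `M/K` (in the universe of `K`) and every
Artin representation `σ` of `Γ_K` (on a `Type 0` space with its module topology) induced from a
character of degree one `π : Γ_M → GL_1(ℂ)`, the conductor formula (11.7) (iii) in norm form,
`𝔑(𝔣(σ)) = 𝔑(𝔇_{M/K}) · 𝔑(𝔣(π))` ("`𝔣(L|K, χ_*) = 𝔡_{K'|K}^{χ(1)} N_{K'|K}(𝔣(L|K', χ))`" with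
`χ(1) = 1`, after absolute norms; `h𝔣`), the named fact
`brauer_completedArtinLFunction_eq_prod_zpow` holds — every other input of the printed proof
(Brauer's theorem (10.3); (10.4) (ii), (iv); (11.7) (i)/(11.11) (i)/(12.1) (i) via the Hasse–Arf
theorem; (12.1) (iii); the transitivity of the discriminant; `Λ ≠ 0` on `re s > 1`;
`χ_{ρ^∨} = χ̄_ρ`) being a theorem of the tree or of Mathlib.  **This is the residual obligation of
the named fact.**
[cite: NeukirchANT1999, VII (12.6) proof, with (11.7) (iii) and (12.3) (iii)] [cite: Brauer1947, Thm. 1] -/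
theorem brauer_completedArtinLFunction_eq_prod_zpow_of_artinConductorNat
    (h𝔣 : ∀ (M : Type u) [Field M] [NumberField M] [Algebra K M] (V' : Type) [AddCommGroup V']
      [Module ℂ V'] [TopologicalSpace V'] [FiniteDimensional ℂ V'] [IsModuleTopology ℂ V']
      (σ : GaloisRepresentations.ArtinRep K V') (π : GaloisRepresentations.FramedArtinRep M 1),
      σ.IsInducedFrom π.toArtinRep →
        GaloisRepresentations.GaloisRep.artinConductorNat σ =
          (differentIdeal (𝓞 K) (𝓞 M)).absNorm *
            GaloisRepresentations.GaloisRep.artinConductorNat π.toArtinRep) :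
    brauer_completedArtinLFunction_eq_prod_zpow (K := K) :=
  brauer_completedArtinLFunction_eq_prod_zpow_of_isInducedFrom fun M _ _ _ V' _ _ _ _ _ σ π h _ hs =>
    GaloisRepresentations.completedArtinLFunction_eq_of_isInducedFrom_rankOne_of_artinConductorNat_eq
      σ π h (h𝔣 M V' σ π h) hs

/-- **Brauer's factorisation of the completed Artin L-function, reduced to Neukirch VII
(11.7) (iii) as printed (ideal form).**  Granting, for every `σ ≅ Ind_{Γ_M}^{Γ_K} π` with
`π : Γ_M → GL_1(ℂ)` as above, the identity of ideals of `𝓞 K`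
`𝔣(σ) = 𝔡_{M|K} · N_{M|K}(𝔣(π))` — "`𝔣(L|K, χ_*) = 𝔡_{K'|K}^{χ(1)} N_{K'|K}(𝔣(L|K', χ))`",
`χ(1) = 1`, with `𝔡_{M|K} = N_{M|K}(𝔇_{M|K})` (III (2.9)) and `N_{M|K} = Ideal.relNorm (𝓞 K)` —
the named fact `brauer_completedArtinLFunction_eq_prod_zpow` holds
(`GaloisRep.artinConductorNat_eq_of_artinConductor_eq_relNorm` and
`brauer_completedArtinLFunction_eq_prod_zpow_of_artinConductorNat`).
[cite: NeukirchANT1999, VII (12.6) proof, with (11.7) (iii) and (12.3) (iii)] [cite: Brauer1947, Thm. 1] -/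
theorem brauer_completedArtinLFunction_eq_prod_zpow_of_artinConductor_eq
    (h𝔣 : ∀ (M : Type u) [Field M] [NumberField M] [Algebra K M] (V' : Type) [AddCommGroup V']
      [Module ℂ V'] [TopologicalSpace V'] [FiniteDimensional ℂ V'] [IsModuleTopology ℂ V']
      (σ : GaloisRepresentations.ArtinRep K V') (π : GaloisRepresentations.FramedArtinRep M 1),
      σ.IsInducedFrom π.toArtinRep →
        GaloisRepresentations.GaloisRep.artinConductor σ =
          Ideal.relNorm (𝓞 K) (differentIdeal (𝓞 K) (𝓞 M)) *
            Ideal.relNorm (𝓞 K) (GaloisRepresentations.GaloisRep.artinConductor π.toArtinRep)) :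
    brauer_completedArtinLFunction_eq_prod_zpow (K := K) :=
  brauer_completedArtinLFunction_eq_prod_zpow_of_artinConductorNat fun M _ _ _ V' _ _ _ _ _ σ π h => by
    have := GaloisRepresentations.GaloisRep.artinConductorNat_eq_of_artinConductor_eq_relNorm
      σ π.toArtinRep 1 (by rw [pow_one]; exact h𝔣 M V' σ π h)
    rwa [pow_one] at this

/-- **What is left of Artin's functional equation (Neukirch VII (12.6)) after this file**: the
named fact `artin_functional_equation` for the base field `K` follows from (11.7) (iii) (ideal
form, over `K`) and from the functional equation for characters of degree one over every number
field in the universe of `K` (`artin_functional_equation_rankOne`, i.e. (12.5) with Hecke's (8.6)) —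
the proved glue `artin_functional_equation_of_brauer_of_rankOne`
(`ArtinLFunctionsFunctionalEquation`) fed with
`brauer_completedArtinLFunction_eq_prod_zpow_of_artinConductor_eq`.
[cite: NeukirchANT1999, VII (12.6) proof] [cite: Brauer1947, Thm. 1] -/
theorem artin_functional_equation_of_artinConductor_eq_of_rankOne
    (h𝔣 : ∀ (M : Type u) [Field M] [NumberField M] [Algebra K M] (V' : Type) [AddCommGroup V']
      [Module ℂ V'] [TopologicalSpace V'] [FiniteDimensional ℂ V'] [IsModuleTopology ℂ V']
      (σ : GaloisRepresentations.ArtinRep K V') (π : GaloisRepresentations.FramedArtinRep M 1),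
      σ.IsInducedFrom π.toArtinRep →
        GaloisRepresentations.GaloisRep.artinConductor σ =
          Ideal.relNorm (𝓞 K) (differentIdeal (𝓞 K) (𝓞 M)) *
            Ideal.relNorm (𝓞 K) (GaloisRepresentations.GaloisRep.artinConductor π.toArtinRep))
    (hB : ∀ (M : Type u) [Field M] [NumberField M], artin_functional_equation_rankOne (K := M)) :
    artin_functional_equation (K := K) :=
  artin_functional_equation_of_brauer_of_rankOne
    (brauer_completedArtinLFunction_eq_prod_zpow_of_artinConductor_eq h𝔣) hB

end Lang

/-! ### The same reduction for the explicit monomial models -/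

section Monomial

variable {K : Type u} [Field K] [NumberField K]

/-- **The core step of `ArtinLFunctionsBrauerCompletedProofs` with (12.3) (iii) granted only for
the monomial models at hand.**  Let `q : Γ_K → G` exhibit the finite group `G` as a Galois group
over `K`, and let the Artin representation `ρ₀` have character
`χ_{ρ₀}(γ) = ∑ᵢ mᵢ · (Ind_{Hᵢ}^G θᵢ)(q γ)`, `mᵢ ∈ ℤ`.  If, for the given `s` with `re s > 1`,
`Λ(s, Ind_{Hᵢ}^G θᵢ ∘ q) = Λ(s, ψᵢ)` for every `i` (`hLi`; `ψᵢ = cutCharacter Hᵢ θᵢ`, the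
character of `Γ_{Kᵢ}` cut out by `(Hᵢ, θᵢ)`: this is (12.3) (iii) for these representations,
`ArtinRep.isInducedFrom_monomial`), then `Λ(s, ρ₀) = ∏ᵢ Λ(s, ψᵢ)^{mᵢ}`.  Same proof as
`completedArtinLFunction_eq_prod_zpow_of_character_eq_sum` (equal characters of
`ρ₀ ⊕ ⊕ᵢ σᵢ^{mᵢ⁻}` and `⊕ᵢ σᵢ^{mᵢ⁺}`, additivity and non-vanishing of `Λ`), with Hasse–Arf
supplied by `hasseArf_holds`.
[cite: NeukirchANT1999, VII (12.6) proof, with (10.3) and (12.3)] [cite: Brauer1947, Thm. 1] -/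
theorem completedArtinLFunction_eq_prod_zpow_of_character_eq_sum_of_monomial
    {V : Type} [AddCommGroup V] [Module ℂ V] [FiniteDimensional ℂ V] [TopologicalSpace V]
    [IsModuleTopology ℂ V] (ρ₀ : GaloisRepresentations.ArtinRep K V)
    {G : Type} [Group G] [Fintype G] {q : absoluteGaloisGroup K →* G} (hq : IsArtinQuotient q)
    {ι : Type} [Fintype ι] (Hs : ι → Subgroup G) (θ : ∀ i, Hs i →* ℂˣ) (m : ι → ℤ)
    (hdec : ∀ γ, ρ₀.toRepresentation.character γ =
      ∑ i, (m i : ℂ) * indClassFun (Hs i) (fun h => (θ i h : ℂ)) (q γ))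
    [∀ i, NumberField (quotientFixedField q (Hs i))] {s : ℂ} (hs : 1 < s.re)
    (hLi : ∀ i, GaloisRepresentations.completedArtinLFunction
        (GaloisRepresentations.ArtinRep.monomial hq (Hs i) (θ i)) s =
      GaloisRepresentations.completedArtinLFunction (hq.cutCharacter (Hs i) (θ i)).toArtinRep s) :
    GaloisRepresentations.completedArtinLFunction ρ₀ s =
      ∏ i, GaloisRepresentations.completedArtinLFunction
        (hq.cutCharacter (Hs i) (θ i)).toArtinRep s ^ m i := by
  classical
  have hHA := GaloisRepresentations.hasseArf_family.{u}
  set Lm : ι → ℂ → ℂ := fun i =>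
    GaloisRepresentations.completedArtinLFunction
      (GaloisRepresentations.ArtinRep.monomial hq (Hs i) (θ i)) with hLm
  set χm : ι → absoluteGaloisGroup K → ℂ := fun i γ =>
    indClassFun (Hs i) (fun h => (θ i h : ℂ)) (q γ) with hχm
  -- realisations
  have hRi : ∀ i, HasCompletedArtinRealization (χm i) (Lm i) := fun i =>
    ⟨G ⧸ Hs i → ℂ, _, _, inferInstance, _, inferInstance,
      GaloisRepresentations.ArtinRep.monomial hq (Hs i) (θ i),
      fun γ => GaloisRepresentations.ArtinRep.character_monomial hq (Hs i) (θ i) γ, fun _ _ => rfl⟩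
  have hR0 : HasCompletedArtinRealization (fun γ => ρ₀.toRepresentation.character γ)
      (GaloisRepresentations.completedArtinLFunction ρ₀) :=
    HasCompletedArtinRealization.of_artinRep ρ₀
  -- `m = m⁺ - m⁻` and the two direct sums with equal characters
  set mp : ι → ℕ := fun i => (m i).toNat with hmp
  set mm : ι → ℕ := fun i => (-(m i)).toNat with hmm
  have hm : ∀ i, (m i : ℂ) = (mp i : ℂ) - (mm i : ℂ) := fun i => by
    have := Int.toNat_sub_toNat_neg (m i)
    rw [hmp, hmm]
    exact_mod_cast this.symm
  have hLHS : HasCompletedArtinRealization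
      ((fun γ => ρ₀.toRepresentation.character γ) + ∑ i, mm i • χm i)
      (GaloisRepresentations.completedArtinLFunction ρ₀ * ∏ i, Lm i ^ mm i) :=
    hR0.mul hHA (HasCompletedArtinRealization.sum hHA Finset.univ mm fun i _ => hRi i)
  have hRHS : HasCompletedArtinRealization (∑ i, mp i • χm i) (∏ i, Lm i ^ mp i) :=
    HasCompletedArtinRealization.sum hHA Finset.univ mp fun i _ => hRi i
  have hfeq : ((fun γ => ρ₀.toRepresentation.character γ) + ∑ i, mm i • χm i) =
      ∑ i, mp i • χm i := by
    funext γ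
    simp only [Pi.add_apply, Finset.sum_apply, Pi.smul_apply]
    simp only [nsmul_eq_mul, hdec γ, hm, ← Finset.sum_add_distrib]
    exact Finset.sum_congr rfl fun i _ => by ring
  rw [hfeq] at hLHS
  have hEq := HasCompletedArtinRealization.apply_eq hLHS hRHS hs
  simp only [Pi.mul_apply, Finset.prod_apply, Pi.pow_apply] at hEq
  -- divide by the non-vanishing `Λ(s, σᵢ)` and rewrite with `ψᵢ`
  have hne : ∀ i, Lm i s ≠ 0 := fun i =>
    completedArtinLFunction_ne_zero (GaloisRepresentations.ArtinRep.monomial hq (Hs i) (θ i)) hs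
  calc GaloisRepresentations.completedArtinLFunction ρ₀ s
      = (∏ i, Lm i s ^ mp i) / ∏ i, Lm i s ^ mm i := by
        rw [eq_div_iff (Finset.prod_ne_zero_iff.mpr fun i _ => pow_ne_zero _ (hne i)), hEq]
    _ = ∏ i, Lm i s ^ m i := by
        rw [← Finset.prod_div_distrib]
        refine Finset.prod_congr rfl fun i _ => ?_
        rw [← zpow_natCast, ← zpow_natCast, ← zpow_sub₀ (hne i), ← Int.toNat_sub_toNat_neg (m i)]
    _ = ∏ i, GaloisRepresentations.completedArtinLFunction
          (hq.cutCharacter (Hs i) (θ i)).toArtinRep s ^ m i :=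
        Finset.prod_congr rfl fun i _ => by rw [← hLi i]

/-- **Brauer's factorisation of the completed Artin L-function from (12.3) (iii) for the
monomial models.**  Granting `Λ(s, Ind_H^G θ ∘ q) = Λ(s, ψ_{H,θ})` on `re s > 1` for every finite
Galois quotient `q : Γ_K → G`, subgroup `H ≤ G` and degree-one character `θ` of `H` (`h3m`;
`ψ_{H,θ} = cutCharacter H θ` on `Kᵢ = K̄^{q⁻¹(H)}`; (12.3) (iii) for exactly the representations
occurring in the proof of (12.6)), the named fact `brauer_completedArtinLFunction_eq_prod_zpow`
holds.  Same proof as `brauer_completedArtinLFunction_eq_prod_zpow_of_isInducedFrom_of_hasseArf`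
(Brauer's theorem for the character of `ρ`, the finite quotient `Γ_K / ker ρ`, the conjugate data
for `ρ^∨`), through `completedArtinLFunction_eq_prod_zpow_of_character_eq_sum_of_monomial`.
[cite: NeukirchANT1999, VII (12.6) proof, with (10.3) and (12.3)] [cite: Brauer1947, Thm. 1] -/
theorem brauer_completedArtinLFunction_eq_prod_zpow_of_monomial
    (h3m : ∀ {G : Type} [Group G] [Fintype G] {q : absoluteGaloisGroup K →* G}
      (hq : IsArtinQuotient q) (H : Subgroup G) (θ : H →* ℂˣ)
      [NumberField (quotientFixedField q H)] (s : ℂ), 1 < s.re →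
        GaloisRepresentations.completedArtinLFunction
            (GaloisRepresentations.ArtinRep.monomial hq H θ) s =
          GaloisRepresentations.completedArtinLFunction (hq.cutCharacter H θ).toArtinRep s) :
    brauer_completedArtinLFunction_eq_prod_zpow (K := K) := by
  intro n ρ
  classical
  -- Step 1: `ρ` factors through a finite group `G`
  obtain ⟨G, _, _, q, hq, τ, hτ⟩ :=
    GaloisRepresentations.ArtinRep.exists_isArtinQuotient ρ.toArtinRep
  -- Step 2: Brauer's induction theorem for the character of `τ`
  have hchar : IsCharacter G τ.character := ⟨Fin n → ℂ, _, _, inferInstance, τ, rfl⟩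
  obtain ⟨ι, _, Hs, θ, m, hdec⟩ := brauer_induction_holds G τ.character hchar
  haveI hfin : ∀ i, FiniteDimensional K (quotientFixedField q (Hs i)) := fun i =>
    finiteDimensional_quotientFixedField hq (Hs i)
  haveI : ∀ i, NumberField (quotientFixedField q (Hs i)) := fun i =>
    NumberField.of_module_finite K _
  -- the character of `ρ` and of `ρ^∨` in terms of the Brauer data
  have hχ : ∀ γ, ρ.toArtinRep.toRepresentation.character γ =
      ∑ i, (m i : ℂ) * indClassFun (Hs i) (fun h => (θ i h : ℂ)) (q γ) := by
    intro γ
    have h1 : ρ.toArtinRep.toRepresentation.character γ = τ.character (q γ) := by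
      simp only [Representation.character]
      exact congrArg (LinearMap.trace ℂ _) (hτ γ)
    rw [h1, hdec, Finset.sum_apply]
    simp only [Pi.smul_apply, smul_eq_mul]
  have hχ' : ∀ γ, (GaloisRepresentations.FramedArtinRep.toArtinRep
      (GaloisRepresentations.FramedRep.dual ρ)).toRepresentation.character γ =
      ∑ i, (m i : ℂ) * indClassFun (Hs i) (fun h => (((θ i)⁻¹ h : ℂˣ) : ℂ)) (q γ) := by
    intro γ
    rw [GaloisRepresentations.FramedArtinRep.character_dual_eq_conj, hχ γ, map_sum]
    refine Finset.sum_congr rfl fun i _ => ?_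
    rw [map_mul, map_intCast, indClassFun_inv_eq_conj]
  refine ⟨ι, inferInstance, fun i => quotientFixedField q (Hs i), inferInstance, inferInstance,
    inferInstance, fun i => hq.cutCharacter (Hs i) (θ i), m, fun s hs => ⟨?_, ?_⟩⟩
  · exact completedArtinLFunction_eq_prod_zpow_of_character_eq_sum_of_monomial ρ.toArtinRep hq Hs θ
      m hχ hs fun i => h3m hq (Hs i) (θ i) s hs
  · rw [completedArtinLFunction_eq_prod_zpow_of_character_eq_sum_of_monomial _ hq Hs
      (fun i => (θ i)⁻¹) m hχ' hs fun i => h3m hq (Hs i) (θ i)⁻¹ s hs]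
    exact Finset.prod_congr rfl fun i _ => by rw [← hq.cutCharacter_inv (Hs i) (θ i)]

/-- **Brauer's factorisation of the completed Artin L-function, reduced to (11.7) (iii) for
the monomial models.**  Granting `𝔑(𝔣(Ind_H^G θ ∘ q)) = 𝔑(𝔇_{Kᵢ/K}) · 𝔑(𝔣(ψ_{H,θ}))` for every
finite Galois quotient `q : Γ_K → G`, subgroup `H ≤ G` (fixed field `Kᵢ = K̄^{q⁻¹(H)}`,
`quotientFixedField`) and degree-one character `θ` of `H` (`h𝔣m`; Neukirch (11.7) (iii) for
`χ = θ`, in norm form), the named fact `brauer_completedArtinLFunction_eq_prod_zpow` holds: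
`Ind_H^G θ ∘ q ≅ Ind_{Γ_{Kᵢ}}^{Γ_K} ψ_{H,θ}` (`ArtinRep.isInducedFrom_monomial`), so (12.3) (iii)
for these models follows from `h𝔣m`
(`completedArtinLFunction_eq_of_isInducedFrom_rankOne_of_artinConductorNat_eq`), and
`brauer_completedArtinLFunction_eq_prod_zpow_of_monomial` applies.
[cite: NeukirchANT1999, VII (12.6) proof, with (11.7) (iii) and (12.3) (iii)] [cite: Brauer1947, Thm. 1] -/
theorem brauer_completedArtinLFunction_eq_prod_zpow_of_monomial_artinConductorNat
    (h𝔣m : ∀ {G : Type} [Group G] [Fintype G] {q : absoluteGaloisGroup K →* G}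
      (hq : IsArtinQuotient q) (H : Subgroup G) (θ : H →* ℂˣ)
      [NumberField (quotientFixedField q H)],
        GaloisRepresentations.GaloisRep.artinConductorNat
            (GaloisRepresentations.ArtinRep.monomial hq H θ) =
          (differentIdeal (𝓞 K) (𝓞 (quotientFixedField q H))).absNorm *
            GaloisRepresentations.GaloisRep.artinConductorNat (hq.cutCharacter H θ).toArtinRep) :
    brauer_completedArtinLFunction_eq_prod_zpow (K := K) :=
  brauer_completedArtinLFunction_eq_prod_zpow_of_monomial fun hq H θ _ _ hs =>
    GaloisRepresentations.completedArtinLFunction_eq_of_isInducedFrom_rankOne_of_artinConductorNat_eq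
      _ _ (GaloisRepresentations.ArtinRep.isInducedFrom_monomial hq H θ) (h𝔣m hq H θ) hs

/-- **Brauer's factorisation of the completed Artin L-function, reduced to (11.7) (iii) as
printed (ideal form) for the monomial models**: granting
`𝔣(Ind_H^G θ ∘ q) = 𝔡_{Kᵢ|K} · N_{Kᵢ|K}(𝔣(ψ_{H,θ}))` as ideals of `𝓞 K` for every finite Galois
quotient `q : Γ_K → G`, `H ≤ G` and degree-one `θ` (`𝔡 = relNorm 𝔇`, `N = Ideal.relNorm (𝓞 K)`),
the named fact holds.
[cite: NeukirchANT1999, VII (12.6) proof, with (11.7) (iii) and (12.3) (iii)] [cite: Brauer1947, Thm. 1] -/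
theorem brauer_completedArtinLFunction_eq_prod_zpow_of_monomial_artinConductor_eq
    (h𝔣m : ∀ {G : Type} [Group G] [Fintype G] {q : absoluteGaloisGroup K →* G}
      (hq : IsArtinQuotient q) (H : Subgroup G) (θ : H →* ℂˣ)
      [NumberField (quotientFixedField q H)],
        GaloisRepresentations.GaloisRep.artinConductor
            (GaloisRepresentations.ArtinRep.monomial hq H θ) =
          Ideal.relNorm (𝓞 K) (differentIdeal (𝓞 K) (𝓞 (quotientFixedField q H))) *
            Ideal.relNorm (𝓞 K)
              (GaloisRepresentations.GaloisRep.artinConductor (hq.cutCharacter H θ).toArtinRep)) :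
    brauer_completedArtinLFunction_eq_prod_zpow (K := K) :=
  brauer_completedArtinLFunction_eq_prod_zpow_of_monomial_artinConductorNat fun hq H θ _ => by
    have := GaloisRepresentations.GaloisRep.artinConductorNat_eq_of_artinConductor_eq_relNorm
      (GaloisRepresentations.ArtinRep.monomial hq H θ) (hq.cutCharacter H θ).toArtinRep 1
      (by rw [pow_one]; exact h𝔣m hq H θ)
    rwa [pow_one] at this

end Monomial

end Literature.NumberTheory.Automorphic

end
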